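import Summits.HodgeConjecture.HodgeConjecture.Theorems.F0P3cStCharTSKeys3TorusConjBall         -- (this seat) `image_torusConj_normBall`, ball differences, `isCompact_normBall_of_chart`; brings ★ B3
import Summits.HodgeConjecture.HodgeConjecture.Theorems.F0P3cStCharTSKeys3ShellVanishingCM     -- ★ (LH6-p04) `integral_annulus_heisZ_dite_chiInvConj_eq_zero`; brings ★ DICT ×2
import Summits.HodgeConjecture.HodgeConjecture.Theorems.F0P3cStCharTSCellFunFarOut             -- ★ B4 (LH6-p04) `exists_toFun_weylElt_mul_eq_smul_toFun_one`
import Literature.NumberTheory.Automorphic.SmoothIndOpenCellHaarFunctional                     -- ★ `SmoothInd.continuous_cellFun`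
import HarnessLib

/-!
# F0 · P3c · «StCharTS» — ROAD «KEYS3-ANALYTIC», «ANNULUS VANISHING AT THE CM PLACE★» (analytic evaluation half of the dock B6b, MEMO v3 §1, §5 (b)):
# for EVERY vector `f ∈ i_G(χ₁, χ₂)` (`v` non-split, `χ₁|_{F_v^×} = 1`, `χ₁ ≠ 1`), every unit `α` (`Q = ‖α‖`), and every large `A`,
# `∫_{K_{A/Q²}} f(w₀ u) du − ∫_{K_A} f(w₀ u) du = 0`, `K_A = {u ∈ N : ‖u₀₂‖ ≤ A}` (`t⁻¹ K_A t = K_{A/‖d₀‖²}`) [Keys1984 §7 Thm. (1); Rogawski1990 §12.2 (3); Casselman1995 §6.3]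

Cell `pub/hodgecm-mathlib`, crux H413 = `stmt-HodgeConjecture-24833` (lane `--supports … --as helper`), route HCCMUnconditional; seat F0P2-p06 (g21), ROAD holder
(LEAD F0P3a-plan T15-03).  THEOREMS ONLY (0 def ∕ 0 instance ∕ 0 notation ∕ 0 sorry); ★-only imports.

The difference of the two set integrals is `±` the integral of the cell function `F(u) = f(w₀ u)` over an annulus `{A/Q² < ‖u₀₂‖ ≤ A}` (`Q = ‖d₀‖` for `t = diag(d)`;
`t⁻¹ K_A t = K_{A/Q²}`, this seat's `image_torusConj_normBall`; for `Q = 1` the difference is `0` outright, for `Q < 1` the annulus is `{A < ‖u₀₂‖ ≤ A/Q²}`).  Far out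
(`‖u₀₂‖ ≥ A₀(f)`, ★ B4 «CELL FUNCTION FAR OUT») `F(u) = (χ₂(−1) f(1)) • (‖z‖⁻¹ • χ₁(σ ẑ)⁻¹)` with `z = u₀₂`, so by ★ `integral_heisHaar_comp_entry` the annulus integral is
`(χ₂(−1) f(1)) •` the chart integral killed by ★ «KEYS (3) SHELL VANISHING AT THE CM PLACE» (`integral_annulus_heisZ_dite_chiInvConj_eq_zero`, the docked ★ B3: a non-trivial
character of `E¹ ≅ E^×/F^×` integrates to zero over a fundamental domain).  No case distinction on the ramification of `E_w/F_v` or on `|2|` enters.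
* `exists_forall_setIntegral_normBall_sub_eq_zero` — the head, for the coordinate Haar measure ★ `HeisRing.heisHaar σ hσ hσc hJ μX μY` of `N(L⁺_v)` and ANY unit `α` (`Q = ‖α‖`;
  at `α = d₀` the two balls are `t⁻¹ K_A t = K_{A/Q²}` and `K_A`, this seat's ★ `image_torusConj_normBall`).
The representation end (★ B5 annulus formula: `∫_N g₀(m)(w₀ n) dμ = b • (∫_{c(K_A)} F − ∫_{K_A} F)`) and the split test (★ `F0P3cStCharTSKeys3SplitTestDatum`) are F0P2-p01's;
together they give `r_B(m)[f₀] = χ(m)[f₀]` for all `m`, whence `hSecond` by ★ B6a and `hKeysRed3` by ★ `keysRedThree_of_secondEigenfunctional`.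
HONEST LABEL: HC_CM is proved only modulo the 7 printed citations (2 remaining named inputs: hLiu418 = `stmt-HodgeConjecture-24832`, h413 = `stmt-HodgeConjecture-24833`) until rung 0
closes; count-neutral.

## References
* [Keys1984] D. Keys, *Principal series representations of special unitary groups over local fields*, Compositio Math. 51 (1984), §7 Thm. (1) p. 126.
* [Rogawski1990] J. Rogawski, *Automorphic representations of unitary groups in three variables*, Annals of Math. Studies 123 (1990), §1.10 p. 9, §12.2 (3) pp. 173–174.
* [Casselman1995] W. Casselman, *Introduction to the theory of admissible representations of p-adic reductive groups* (1995), §6.3, §6.4.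
-/

set_option autoImplicit false
set_option linter.dupNamespace false

noncomputable section

open NumberField IsDedekindDomain MeasureTheory Set
open scoped Matrix NNReal ENNReal
open Literature.NumberTheory.Automorphic Literature.NumberTheory.Automorphic.UnitaryGroup Literature.NumberTheory.Automorphic.UnitaryGroup.HeisRing
open Literature.NumberTheory.GaloisRepresentations Literature.NumberTheory.GaloisRepresentations.IsNonarchimedeanLocalField
open Summit.HodgeConjecture.HodgeConjecture.Cruxes.H413
open Summit.HodgeConjecture.HodgeConjecture.Cruxes.H413.F0P3cStCharTSLocalRingNormDictionary
open Summit.HodgeConjecture.HodgeConjecture.Cruxes.H413.F0P3cStCharTSLocalRingNormCompactness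
open Summit.HodgeConjecture.HodgeConjecture.Cruxes.H413.F0P3cStCharTSKeys3TorusConjBall
open Summit.HodgeConjecture.HodgeConjecture.Cruxes.H413.F0P3cStCharTSBigCellFactorisation

namespace Summit.HodgeConjecture.HodgeConjecture.Cruxes.H413.F0P3cStCharTSKeys3AnnulusVanishing

variable (L : Type) [Field L] [NumberField L] [IsCMField L] (v : HeightOneSpectrum (𝓞 ↥(maximalRealSubfield L)))
  (hns : ∀ w : PlacesOver L v, IsCMField.complexConj L • w.1 = w.1)

/-! ## §1 Two real-number bookkeeping lemmas for the thresholds -/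

/-- `(A₀ + 1) · max 1 Q² ≤ A ⇒ A₀ + 1 ≤ A`. [cite: Casselman1995, §6.3] -/
theorem threshold_le {A₀ Q A : ℝ} (hA₀ : 0 ≤ A₀) (hA : (A₀ + 1) * max 1 (Q ^ 2) ≤ A) : A₀ + 1 ≤ A :=
  le_trans (le_mul_of_one_le_right (by linarith) (le_max_left _ _)) hA

/-- `(A₀ + 1) · max 1 Q² ≤ A ⇒ A₀ + 1 ≤ A / Q²` (`0 < Q`). [cite: Casselman1995, §6.3] -/
theorem threshold_le_div {A₀ Q A : ℝ} (hA₀ : 0 ≤ A₀) (hQ : 0 < Q) (hA : (A₀ + 1) * max 1 (Q ^ 2) ≤ A) : A₀ + 1 ≤ A / Q ^ 2 := by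
  rw [le_div_iff₀ (pow_pos hQ 2)]
  exact le_trans (mul_le_mul_of_nonneg_left (le_max_right _ _) (by linarith)) hA

/-! ## §2 The head -/

include hns in
open scoped Classical in
set_option synthInstance.maxHeartbeats 400000 in
set_option maxHeartbeats 3200000 in
-- statement∕proof-heavy: the `SmoothInd` carrier of ★ `cmPrincipalSeries` (class of ★ B4 `exists_toFun_weylElt_mul_eq_smul_toFun_one`)
/-- **«ANNULUS VANISHING AT THE CM PLACE★».**  `v` non-split, `χ₁|_{F_v^×} = 1`, `χ₁ ≠ 1`, `w₀` of matrix `Φ₃`, `f` ANY vector of `i_G(χ₁, χ₂)`, `t ∈ T(L⁺_v)`, `μ = heisHaar` the coordinate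
Haar measure of `N(L⁺_v)`, `α ∈ R^×` ANY unit with module `Q = ‖α‖_R`: there is `A₁` such that for all `A ≥ A₁`, with `K_A = {u ∈ N : ‖u₀₂‖ ≤ A}` (`‖·‖ = Π_{w'} |·|_{w'}`),
  `∫_{K_{A/Q²}} f(w₀ u) dμ(u) − ∫_{K_A} f(w₀ u) dμ(u) = 0`
(for `t = diag(d) ∈ T`, `t⁻¹ K_A t = K_{A/‖d₀‖²}` by ★ `image_torusConj_normBall`, so this is the bracket of ★ B5's annulus formula at `α = d₀`).
[cite: Keys1984, §7 Thm. (1) p. 126] [cite: Rogawski1990, §12.2 (3) p. 174] [cite: Casselman1995, §6.3, §6.4] -/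
theorem exists_forall_setIntegral_normBall_sub_eq_zero [MeasurableSpace (LocalRing L v)] [BorelSpace (LocalRing L v)] [Invertible (2 : LocalRing L v)]
    (χ₁ : (LocalRing L v)ˣ →* ℂˣ) (χ₂ : ↥(normOneUnits (conjLocal L (IsCMField.complexConj L) v)) →* ℂˣ)
    (h₁ : Continuous fun x => ((χ₁ x : ℂˣ) : ℂ))
    (htriv : ∀ a : (LocalRing L v)ˣ, (conjLocal L (IsCMField.complexConj L) v) (a : LocalRing L v) = a → χ₁ a = 1) (hne : χ₁ ≠ 1)
    (w₀ : ↥(unitaryGroupOfForm (conjLocal L (IsCMField.complexConj L) v) (cmLocalForm L 3 v)))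
    (hw₀ : Units.val (w₀ : GL (Fin 3) (LocalRing L v)) = cmLocalForm L 3 v)
    (μX : Measure (LocalRing L v)) [μX.IsAddHaarMeasure]
    (μY : Measure ↥(skewPart (conjLocal L (IsCMField.complexConj L) v))) [μY.IsAddHaarMeasure] [μY.Regular]
    [MeasurableSpace ↥(cmBorelTriple L 3 v).N] [BorelSpace ↥(cmBorelTriple L 3 v).N]
    (α : (LocalRing L v)ˣ)
    (f : haveI := locallyCompactSpace_cmBorelU L 3 v
      Representation.SmoothInd (cmBorelTriple L 3 v).P
        (Representation.twist
          (((Representation.trivial ℂ ↥(torusU (conjLocal L (IsCMField.complexConj L) v) (cmLocalForm L 3 v)) ℂ).twist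
            (cmTorusCharPair L v χ₁ χ₂)).comp (cmBorelTriple L 3 v).proj) (rootDeltaChar (cmBorelTriple L 3 v).P))) :
    ∃ A₁ : ℝ, ∀ A : ℝ, A₁ ≤ A →
      ∫ u in {u : ↥(cmBorelTriple L 3 v).N | ((∏ w' : PlacesOver L v, normAbs (w'.1.adicCompletion L)
            ((((u : ↥(unitaryGroupOfForm (conjLocal L (IsCMField.complexConj L) v) (cmLocalForm L 3 v))) : GL (Fin 3) (LocalRing L v)) :
              Matrix (Fin 3) (Fin 3) (LocalRing L v)) 0 2 w') : ℝ≥0) : ℝ) ≤ A / ((distribHaarChar (LocalRing L v) α : ℝ) ^ 2)},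
          f.toFun ((w₀ : ↥(unitaryGroupOfForm (conjLocal L (IsCMField.complexConj L) v) (cmLocalForm L 3 v))) * u)
          ∂(heisHaar (conjLocal L (IsCMField.complexConj L) v) (conjLocal_conjLocal_cm L v) (continuous_conjLocal L (IsCMField.complexConj L) v)
              (cmLocalForm_eq_over L 3 v) μX μY) -
        ∫ u in {u : ↥(cmBorelTriple L 3 v).N | ((∏ w' : PlacesOver L v, normAbs (w'.1.adicCompletion L)
            ((((u : ↥(unitaryGroupOfForm (conjLocal L (IsCMField.complexConj L) v) (cmLocalForm L 3 v))) : GL (Fin 3) (LocalRing L v)) :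
              Matrix (Fin 3) (Fin 3) (LocalRing L v)) 0 2 w') : ℝ≥0) : ℝ) ≤ A},
          f.toFun ((w₀ : ↥(unitaryGroupOfForm (conjLocal L (IsCMField.complexConj L) v) (cmLocalForm L 3 v))) * u)
          ∂(heisHaar (conjLocal L (IsCMField.complexConj L) v) (conjLocal_conjLocal_cm L v) (continuous_conjLocal L (IsCMField.complexConj L) v)
              (cmLocalForm_eq_over L 3 v) μX μY) = 0 := by
  haveI := locallyCompactSpace_cmBorelU L 3 v
  obtain ⟨w⟩ : Nonempty (PlacesOver L v) := inferInstance
  have hw := hns w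
  have hσ := conjLocal_conjLocal_cm L v
  have hσc := continuous_conjLocal L (IsCMField.complexConj L) v
  have hJ := cmLocalForm_eq_over L 3 v
  -- the modulus `Q = ‖α‖`
  have hQpos : (0 : ℝ) < (distribHaarChar (LocalRing L v) α : ℝ) := NNReal.coe_pos.2 distribHaarChar_pos
  -- the far-out threshold of ★ B4
  obtain ⟨A₀, hA₀⟩ := F0P3cStCharTSCellFunFarOut.exists_toFun_weylElt_mul_eq_smul_toFun_one L v hns χ₁ χ₂ w₀ hw₀ f
  refine ⟨((A₀ : ℝ) + 1) * max 1 ((distribHaarChar (LocalRing L v) α : ℝ) ^ 2), fun A hA => ?_⟩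
  have hA1 : (A₀ : ℝ) + 1 ≤ A := threshold_le A₀.coe_nonneg hA
  have hAQ : (A₀ : ℝ) + 1 ≤ A / (distribHaarChar (LocalRing L v) α : ℝ) ^ 2 := threshold_le_div A₀.coe_nonneg hQpos hA
  have hApos : 0 < A := by have := A₀.coe_nonneg; linarith
  -- continuity ∕ measurability of the entry `z(u) = u₀₂`, of `nrm ∘ z`, of the cell function; compactness of the balls
  have hz : Continuous fun u : ↥(cmBorelTriple L 3 v).N =>
      (((u : ↥(unitaryGroupOfForm (conjLocal L (IsCMField.complexConj L) v) (cmLocalForm L 3 v))) : GL (Fin 3) (LocalRing L v)) :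
        Matrix (Fin 3) (Fin 3) (LocalRing L v)) 0 2 :=
    (Units.continuous_val.comp (continuous_subtype_val.comp continuous_subtype_val)).matrix_elem 0 2
  have hν : Measurable fun u : ↥(cmBorelTriple L 3 v).N => ((∏ w' : PlacesOver L v, normAbs (w'.1.adicCompletion L)
      ((((u : ↥(unitaryGroupOfForm (conjLocal L (IsCMField.complexConj L) v) (cmLocalForm L 3 v))) : GL (Fin 3) (LocalRing L v)) :
        Matrix (Fin 3) (Fin 3) (LocalRing L v)) 0 2 w') : ℝ≥0) : ℝ) :=
    (NNReal.continuous_coe.comp ((continuous_prod_normAbs L v).comp hz)).measurable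
  have hF : Continuous fun u : ↥(cmBorelTriple L 3 v).N =>
      f.toFun ((w₀ : ↥(unitaryGroupOfForm (conjLocal L (IsCMField.complexConj L) v) (cmLocalForm L 3 v))) * u) :=
    SmoothInd.continuous_cellFun (cmBorelTriple L 3 v).P _ (cmBorelTriple L 3 v).N.subtype _ continuous_subtype_val f
  have hK : ∀ B : ℝ, IsCompact {u : ↥(cmBorelTriple L 3 v).N | ((∏ w' : PlacesOver L v, normAbs (w'.1.adicCompletion L)
      ((((u : ↥(unitaryGroupOfForm (conjLocal L (IsCMField.complexConj L) v) (cmLocalForm L 3 v))) : GL (Fin 3) (LocalRing L v)) :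
        Matrix (Fin 3) (Fin 3) (LocalRing L v)) 0 2 w') : ℝ≥0) : ℝ) ≤ B} := fun B =>
    isCompact_normBall_of_chart (nrm := fun b : LocalRing L v => ∏ w' : PlacesOver L v, normAbs (w'.1.adicCompletion L) (b w'))
      (conjLocal L (IsCMField.complexConj L) v) hσ hσc hJ (isCompact_setOf_prod_normAbs_heisZ_le L v w hw B)
  -- far out, the cell function is `(χ₂(−1) f(1)) • (‖z‖⁻¹ • χ₁(σ ẑ)⁻¹)` (★ B4 + ★ `unitModulusChar_localRing_eq_prod`)
  have hfar : ∀ u : ↥(cmBorelTriple L 3 v).N, (A₀ : ℝ) + 1 ≤ ((∏ w' : PlacesOver L v, normAbs (w'.1.adicCompletion L)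
      ((((u : ↥(unitaryGroupOfForm (conjLocal L (IsCMField.complexConj L) v) (cmLocalForm L 3 v))) : GL (Fin 3) (LocalRing L v)) :
        Matrix (Fin 3) (Fin 3) (LocalRing L v)) 0 2 w') : ℝ≥0) : ℝ) →
      f.toFun ((w₀ : ↥(unitaryGroupOfForm (conjLocal L (IsCMField.complexConj L) v) (cmLocalForm L 3 v))) * u) =
        (((χ₂ ⟨-1, neg_one_mem_normOneUnits (conjLocal L (IsCMField.complexConj L) v)⟩ : ℂˣ) : ℂ) * f.toFun 1) •
          (fun b : LocalRing L v => ((∏ w' : PlacesOver L v, normAbs (w'.1.adicCompletion L) (b w'))⁻¹ : ℝ≥0) •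
            (fun b : LocalRing L v => if hb : IsUnit b then
              (((χ₁ (Units.map (conjLocal L (IsCMField.complexConj L) v : LocalRing L v →* LocalRing L v) hb.unit))⁻¹ : ℂˣ) : ℂ) else 0) b)
          ((((u : ↥(unitaryGroupOfForm (conjLocal L (IsCMField.complexConj L) v) (cmLocalForm L 3 v))) : GL (Fin 3) (LocalRing L v)) :
            Matrix (Fin 3) (Fin 3) (LocalRing L v)) 0 2) := by
    intro u hu
    have hpos : (0 : ℝ) < ((∏ w' : PlacesOver L v, normAbs (w'.1.adicCompletion L)
        ((((u : ↥(unitaryGroupOfForm (conjLocal L (IsCMField.complexConj L) v) (cmLocalForm L 3 v))) : GL (Fin 3) (LocalRing L v)) :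
          Matrix (Fin 3) (Fin 3) (LocalRing L v)) 0 2 w') : ℝ≥0) : ℝ) := by
      have := A₀.coe_nonneg; linarith
    have hne0 : (((u : ↥(unitaryGroupOfForm (conjLocal L (IsCMField.complexConj L) v) (cmLocalForm L 3 v))) : GL (Fin 3) (LocalRing L v)) :
        Matrix (Fin 3) (Fin 3) (LocalRing L v)) 0 2 ≠ 0 := by
      intro h0
      rw [h0, (prod_normAbs_eq_zero_iff L v w hw 0).2 rfl, NNReal.coe_zero] at hpos
      exact lt_irrefl _ hpos
    have hb := (isUnit_iff_ne_zero_localRing L v w hw _).2 hne0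
    have hmod : unitModulusChar (LocalRing L v) hb.unit = ∏ w' : PlacesOver L v, normAbs (w'.1.adicCompletion L)
        ((((u : ↥(unitaryGroupOfForm (conjLocal L (IsCMField.complexConj L) v) (cmLocalForm L 3 v))) : GL (Fin 3) (LocalRing L v)) :
          Matrix (Fin 3) (Fin 3) (LocalRing L v)) 0 2 w') := by
      rw [unitModulusChar_localRing_eq_prod, hb.unit_spec]
    have hle : A₀ ≤ unitModulusChar (LocalRing L v) hb.unit := by
      rw [← NNReal.coe_le_coe, hmod]; linarith
    rw [hA₀ u hb hle]
    beta_reduce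
    rw [dif_pos hb, smul_eq_mul, NNReal.smul_def, Complex.real_smul, hmod, NNReal.coe_inv]
    push_cast
    ring
  -- `c(K_A) = K_{A/Q²}`
  haveI : SecondCountableTopology (LocalRing L v) := secondCountableTopology_localRing (E := L) v
  haveI := isHaarMeasure_heisHaar (conjLocal L (IsCMField.complexConj L) v) hσ hσc hJ μX μY
  rcases lt_trichotomy (distribHaarChar (LocalRing L v) α) 1 with hQ | hQ | hQ
  · -- `Q < 1`: the image is the LARGER ball, the difference is the annulus `{A < ‖z‖ ≤ A/Q²}`, killed with `α = d₀⁻¹`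
    have hAB : A ≤ A / (distribHaarChar (LocalRing L v) α : ℝ) ^ 2 := by
      rw [le_div_iff₀ (pow_pos hQpos 2)]
      have hQ1 : (distribHaarChar (LocalRing L v) α : ℝ) ^ 2 ≤ 1 := pow_le_one₀ hQpos.le (by exact_mod_cast hQ.le)
      nlinarith
    have hQ' : 1 < distribHaarChar (LocalRing L v) α⁻¹ := by rw [map_inv]; exact one_lt_inv_iff₀.2 ⟨distribHaarChar_pos, hQ⟩
    have hI : A / (distribHaarChar (LocalRing L v) α : ℝ) ^ 2 / (distribHaarChar (LocalRing L v) α⁻¹ : ℝ) ^ 2 = A := by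
      rw [map_inv, NNReal.coe_inv, inv_pow, div_inv_eq_mul, div_mul_cancel₀ A (pow_pos hQpos 2).ne']
    rw [setIntegral_ball_sub_setIntegral_ball_of_ge (heisHaar (conjLocal L (IsCMField.complexConj L) v) hσ hσc hJ μX μY) hν _ hAB
      (hF.continuousOn.integrableOn_compact (hK _))]
    have hset : (fun u : ↥(cmBorelTriple L 3 v).N => ((∏ w' : PlacesOver L v, normAbs (w'.1.adicCompletion L)
        ((((u : ↥(unitaryGroupOfForm (conjLocal L (IsCMField.complexConj L) v) (cmLocalForm L 3 v))) : GL (Fin 3) (LocalRing L v)) :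
          Matrix (Fin 3) (Fin 3) (LocalRing L v)) 0 2 w') : ℝ≥0) : ℝ)) ⁻¹' Set.Ioc A (A / (distribHaarChar (LocalRing L v) α : ℝ) ^ 2) =
        (fun u : ↥(cmBorelTriple L 3 v).N => (((u : ↥(unitaryGroupOfForm (conjLocal L (IsCMField.complexConj L) v) (cmLocalForm L 3 v))) :
          GL (Fin 3) (LocalRing L v)) : Matrix (Fin 3) (Fin 3) (LocalRing L v)) 0 2) ⁻¹'
          ((fun b : LocalRing L v => ((∏ w' : PlacesOver L v, normAbs (w'.1.adicCompletion L) (b w') : ℝ≥0) : ℝ)) ⁻¹'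
            Set.Ioc (A / (distribHaarChar (LocalRing L v) α : ℝ) ^ 2 / (distribHaarChar (LocalRing L v) α⁻¹ : ℝ) ^ 2)
              (A / (distribHaarChar (LocalRing L v) α : ℝ) ^ 2)) := by
      rw [hI]; rfl
    rw [hset, setIntegral_preimage_eq_integral_indicator_comp
      (heisHaar (conjLocal L (IsCMField.complexConj L) v) hσ hσc hJ μX μY) _ hz.measurable ((measurable_prod_normAbs L v).coe_nnreal_real measurableSet_Ioc)
      (fun b : LocalRing L v =>
        (((χ₂ ⟨-1, neg_one_mem_normOneUnits (conjLocal L (IsCMField.complexConj L) v)⟩ : ℂˣ) : ℂ) * f.toFun 1) •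
          (fun b : LocalRing L v => ((∏ w' : PlacesOver L v, normAbs (w'.1.adicCompletion L) (b w'))⁻¹ : ℝ≥0) •
            (fun b : LocalRing L v => if hb : IsUnit b then
              (((χ₁ (Units.map (conjLocal L (IsCMField.complexConj L) v : LocalRing L v →* LocalRing L v) hb.unit))⁻¹ : ℂˣ) : ℂ) else 0) b) b)
      (fun u hu => hfar u (le_trans (by rw [hI]; exact hA1) (le_of_lt hu.1))), integral_indicator_const_smul_comp,
      F0P3cStCharTSHeisenbergAnnulusSlice.integral_heisHaar_comp_entry (conjLocal L (IsCMField.complexConj L) v) (conjLocal_conjLocal_cm L v)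
        (continuous_conjLocal L (IsCMField.complexConj L) v) (cmLocalForm_eq_over L 3 v) μX μY (Set.indicator _ _)]
    have h0 := F0P3cStCharTSKeys3ShellVanishingCM.integral_annulus_heisZ_dite_chiInvConj_eq_zero L v w hw χ₁ hns h₁ htriv hne μX μY α⁻¹ hQ'
      (lt_of_lt_of_le hApos hAB)
    simp only [h0, smul_zero]
  · -- `Q = 1`: `c(K_A) = K_A`
    rw [hQ, NNReal.coe_one, one_pow, div_one, sub_self]
  · -- `1 < Q`: the image is the SMALLER ball, the difference is `−` the annulus `{A/Q² < ‖z‖ ≤ A}`, killed with `α = d₀`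
    have hBA : A / (distribHaarChar (LocalRing L v) α : ℝ) ^ 2 ≤ A :=
      div_le_self hApos.le (one_le_pow₀ (by exact_mod_cast hQ.le))
    rw [setIntegral_ball_sub_setIntegral_ball_of_le (heisHaar (conjLocal L (IsCMField.complexConj L) v) hσ hσc hJ μX μY) hν _ hBA
      (hF.continuousOn.integrableOn_compact (hK _))]
    have hset : (fun u : ↥(cmBorelTriple L 3 v).N => ((∏ w' : PlacesOver L v, normAbs (w'.1.adicCompletion L)
        ((((u : ↥(unitaryGroupOfForm (conjLocal L (IsCMField.complexConj L) v) (cmLocalForm L 3 v))) : GL (Fin 3) (LocalRing L v)) :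
          Matrix (Fin 3) (Fin 3) (LocalRing L v)) 0 2 w') : ℝ≥0) : ℝ)) ⁻¹' Set.Ioc (A / (distribHaarChar (LocalRing L v) α : ℝ) ^ 2) A =
        (fun u : ↥(cmBorelTriple L 3 v).N => (((u : ↥(unitaryGroupOfForm (conjLocal L (IsCMField.complexConj L) v) (cmLocalForm L 3 v))) :
          GL (Fin 3) (LocalRing L v)) : Matrix (Fin 3) (Fin 3) (LocalRing L v)) 0 2) ⁻¹'
          ((fun b : LocalRing L v => ((∏ w' : PlacesOver L v, normAbs (w'.1.adicCompletion L) (b w') : ℝ≥0) : ℝ)) ⁻¹'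
            Set.Ioc (A / (distribHaarChar (LocalRing L v) α : ℝ) ^ 2) A) := rfl
    rw [hset, setIntegral_preimage_eq_integral_indicator_comp
      (heisHaar (conjLocal L (IsCMField.complexConj L) v) hσ hσc hJ μX μY) _ hz.measurable ((measurable_prod_normAbs L v).coe_nnreal_real measurableSet_Ioc)
      (fun b : LocalRing L v =>
        (((χ₂ ⟨-1, neg_one_mem_normOneUnits (conjLocal L (IsCMField.complexConj L) v)⟩ : ℂˣ) : ℂ) * f.toFun 1) •
          (fun b : LocalRing L v => ((∏ w' : PlacesOver L v, normAbs (w'.1.adicCompletion L) (b w'))⁻¹ : ℝ≥0) •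
            (fun b : LocalRing L v => if hb : IsUnit b then
              (((χ₁ (Units.map (conjLocal L (IsCMField.complexConj L) v : LocalRing L v →* LocalRing L v) hb.unit))⁻¹ : ℂˣ) : ℂ) else 0) b) b)
      (fun u hu => hfar u (le_trans hAQ (le_of_lt hu.1))), integral_indicator_const_smul_comp,
      F0P3cStCharTSHeisenbergAnnulusSlice.integral_heisHaar_comp_entry (conjLocal L (IsCMField.complexConj L) v) (conjLocal_conjLocal_cm L v)
        (continuous_conjLocal L (IsCMField.complexConj L) v) (cmLocalForm_eq_over L 3 v) μX μY (Set.indicator _ _)]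
    have h0 := F0P3cStCharTSKeys3ShellVanishingCM.integral_annulus_heisZ_dite_chiInvConj_eq_zero L v w hw χ₁ hns h₁ htriv hne μX μY α hQ hApos
    simp only [h0, smul_zero, neg_zero]

end Summit.HodgeConjecture.HodgeConjecture.Cruxes.H413.F0P3cStCharTSKeys3AnnulusVanishing

end
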